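import Literature.Analysis.PDE.AnalyticPropagationOfSmallnessOneDim
import Mathlib.Analysis.Calculus.IteratedDeriv.Lemmas
import HarnessLib

/-!
# Propagation of smallness for functions with factorial derivative bounds — the one-dimensional chain

Second step towards the named fact `Literature.Analysis.PDE.analyticPropagationOfSmallness`
(Apraiz–Escauriaza–Wang–Zhang 2014, Thm 4 / Vessella 1999): from the short-interval Hölder bound
`AnalyticSmallness.abs_le_rpow_short` to an interval `[a,b]` of ANY length `≤ r/ρ'` (`r` the
analyticity scale): cut `[a,b]` into `m = ⌈128e/(σρ')⌉` equal pieces, find a piece on which the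
small set has density `≥ σ` (pigeonhole), bound `g` there, and propagate piece by piece (each piece
is half of the next doubled piece; the leftward run is the rightward run of `t ↦ g(-t)`).  Result
`exists_oneDim_propagation`: constants `N = 8^{m+1}`, `θ = θ_σ θ_{1/2}^m` depending on `σ, ρ'` only.
Theorems only.
-/

noncomputable section

open Set MeasureTheory Real

namespace Literature.Analysis.PDE

namespace AnalyticSmallness

/-- Every point of `[lo, lo + nℓ]` (`n ≥ 1`, `ℓ > 0`) lies in one of the `n` pieces
`[lo + kℓ, lo + (k+1)ℓ]`. [folklore] -/
private theorem exists_piece_of_mem {lo ℓ : ℝ} (hℓ : 0 < ℓ) {n : ℕ} (hn : 0 < n) {t : ℝ}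
    (ht : t ∈ Icc lo (lo + n * ℓ)) :
    ∃ k : ℕ, k < n ∧ t ∈ Icc (lo + k * ℓ) (lo + (k + 1) * ℓ) := by
  have h0 : 0 ≤ (t - lo) / ℓ := div_nonneg (sub_nonneg.2 ht.1) hℓ.le
  set j := ⌊(t - lo) / ℓ⌋₊ with hj
  by_cases hjn : j < n
  · refine ⟨j, hjn, ?_, ?_⟩
    · have h1 : (j : ℝ) ≤ (t - lo) / ℓ := Nat.floor_le h0
      rw [le_div_iff₀ hℓ] at h1
      linarith
    · have h2 : (t - lo) / ℓ < j + 1 := Nat.lt_floor_add_one _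
      rw [div_lt_iff₀ hℓ] at h2
      linarith
  · push Not at hjn
    refine ⟨n - 1, Nat.sub_lt hn one_pos, ?_, ?_⟩
    · have h1 : (j : ℝ) ≤ (t - lo) / ℓ := Nat.floor_le h0
      rw [le_div_iff₀ hℓ] at h1
      have h3 : ((n - 1 : ℕ) : ℝ) ≤ j := by
        have : n - 1 ≤ j := by omega
        exact_mod_cast this
      nlinarith
    · rw [Nat.cast_sub (Nat.one_le_of_lt hn), Nat.cast_one, sub_add_cancel]
      exact ht.2

/-- **Pigeonhole**: if `S ⊆ [a, a + mℓ]` has (outer) measure `≥ σ m ℓ`, some piece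
`[a + iℓ, a + (i+1)ℓ]` meets `S` in measure `≥ σ ℓ`. [folklore] -/
private theorem exists_dense_piece {a ℓ σ : ℝ} (hℓ : 0 < ℓ) {m : ℕ} (hm : 0 < m) {S : Set ℝ}
    (hS : S ⊆ Icc a (a + m * ℓ)) (hSvol : ENNReal.ofReal (σ * (m * ℓ)) ≤ volume S) :
    ∃ i : ℕ, i < m ∧
      ENNReal.ofReal (σ * ℓ) ≤ volume (S ∩ Icc (a + i * ℓ) (a + (i + 1) * ℓ)) := by
  by_contra h
  push Not at h
  have hcover : S ⊆ ⋃ i ∈ Finset.range m, S ∩ Icc (a + i * ℓ) (a + (i + 1) * ℓ) := by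
    intro t ht
    obtain ⟨k, hk, hkt⟩ := exists_piece_of_mem hℓ hm (hS ht)
    exact Set.mem_biUnion (Finset.mem_range.2 hk) ⟨ht, hkt⟩
  have hne : (Finset.range m).Nonempty := Finset.nonempty_range_iff.2 hm.ne'
  have hlt : volume S < ENNReal.ofReal (σ * (m * ℓ)) := by
    calc volume S ≤ volume (⋃ i ∈ Finset.range m, S ∩ Icc (a + i * ℓ) (a + (i + 1) * ℓ)) :=
          measure_mono hcover
      _ ≤ ∑ i ∈ Finset.range m, volume (S ∩ Icc (a + i * ℓ) (a + (i + 1) * ℓ)) :=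
          measure_biUnion_finset_le _ _
      _ < ∑ _i ∈ Finset.range m, ENNReal.ofReal (σ * ℓ) :=
          ENNReal.sum_lt_sum_of_nonempty hne fun i hi => h i (Finset.mem_range.1 hi)
      _ = ENNReal.ofReal (σ * (m * ℓ)) := by
          rw [Finset.sum_const, Finset.card_range, nsmul_eq_mul, ← ENNReal.ofReal_natCast,
            ← ENNReal.ofReal_mul (Nat.cast_nonneg _)]
          congr 1
          ring
  exact absurd hSvol (not_le.2 hlt)

/-- Monotonicity of the chain bounds `8^{k+1} x^{e₀ ϑᵏ} M` in `k` (`0 ≤ x ≤ 1`, `0 < e₀`,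
`0 < ϑ ≤ 1`). [folklore] -/
private theorem chainBound_mono {x e₀ ϑ M : ℝ} (hx0 : 0 ≤ x) (hx1 : x ≤ 1) (he₀ : 0 < e₀) (hϑ : 0 < ϑ)
    (hϑ1 : ϑ ≤ 1) (hM : 0 ≤ M) {k n : ℕ} (hkn : k ≤ n) :
    8 ^ (k + 1) * x ^ (e₀ * ϑ ^ k) * M ≤ 8 ^ (n + 1) * x ^ (e₀ * ϑ ^ n) * M := by
  have h1 : (8 : ℝ) ^ (k + 1) ≤ 8 ^ (n + 1) := pow_le_pow_right₀ (by norm_num) (by omega)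
  have h2 : x ^ (e₀ * ϑ ^ k) ≤ x ^ (e₀ * ϑ ^ n) :=
    Real.rpow_le_rpow_of_exponent_ge' hx0 hx1 (by positivity)
      (mul_le_mul_of_nonneg_left (pow_le_pow_of_le_one hϑ.le hϑ1 hkn) he₀.le)
  gcongr

/-- **Rightward propagation along a chain of pieces.**  On `[lo, lo + nℓ]` let `g` be smooth with
`|g⁽ᵏ⁾| ≤ M k!/rᵏ`, `2ℓ ≤ r/(64e)`, and `|g| ≤ 8 x^{e₀} M` on the first piece (`0 ≤ x ≤ 1`,
`e₀ > 0`).  Then on the `k`-th piece `|g| ≤ 8^{k+1} x^{e₀ ϑᵏ} M`, `ϑ = log 2/log(32e)` (each step is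
`abs_le_rpow_short` with density `1/2` on the doubled piece). [folklore] -/
private theorem rightward {g : ℝ → ℝ} (hg : ContDiff ℝ (⊤ : ℕ∞) g) {lo ℓ M r x e₀ : ℝ} {n : ℕ}
    (hℓ : 0 < ℓ) (hM : 0 < M) (hr : 0 < r) (hshort : 2 * ℓ ≤ (1 / 2) / (32 * Real.exp 1) * r)
    (hD : ∀ (k : ℕ), ∀ t ∈ Icc lo (lo + n * ℓ),
      |iteratedDeriv k g t| ≤ M * (k.factorial : ℝ) / r ^ k)
    (hx0 : 0 ≤ x)
    (hbase : ∀ t ∈ Icc lo (lo + ℓ), |g t| ≤ 8 * x ^ e₀ * M) :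
    ∀ k : ℕ, k < n → ∀ t ∈ Icc (lo + k * ℓ) (lo + (k + 1) * ℓ),
      |g t| ≤ 8 ^ (k + 1) * x ^ (e₀ * (Real.log 2 / Real.log (32 * Real.exp 1)) ^ k) * M := by
  set ϑ := Real.log 2 / Real.log (32 * Real.exp 1) with hϑ
  have he1 : 1 ≤ Real.exp 1 := Real.one_le_exp (by norm_num)
  have h32 : (2 : ℝ) ≤ 32 * Real.exp 1 := by nlinarith
  have hlog2 : 0 < Real.log 2 := Real.log_pos (by norm_num)
  have hlog32 : 0 < Real.log (32 * Real.exp 1) := Real.log_pos (by nlinarith)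
  have hϑpos : 0 < ϑ := div_pos hlog2 hlog32
  have hϑ1 : ϑ ≤ 1 := (div_le_one hlog32).2 (Real.log_le_log (by norm_num) h32)
  intro k
  induction k with
  | zero =>
    intro _ t ht
    simpa using hbase t (by simpa using ht)
  | succ k ih =>
    intro hk t ht
    -- the doubled piece `J = [lo + kℓ, lo + (k+2)ℓ]`, with `S` = piece `k`
    have hkn : k < n := Nat.lt_of_succ_lt hk
    have hJsub : Icc (lo + k * ℓ) (lo + (k + 2) * ℓ) ⊆ Icc lo (lo + n * ℓ) := by
      refine Icc_subset_Icc (by nlinarith) ?_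
      have : (k : ℝ) + 2 ≤ n := by exact_mod_cast hk
      nlinarith
    have hDJ : ∀ (j : ℕ), ∀ s ∈ Icc (lo + k * ℓ) (lo + (k + 2) * ℓ),
        |iteratedDeriv j g s| ≤ M * (j.factorial : ℝ) / r ^ j := fun j s hs => hD j s (hJsub hs)
    have hab : lo + k * ℓ < lo + (k + 2) * ℓ := by nlinarith
    have hSsub : Icc (lo + k * ℓ) (lo + (k + 1) * ℓ) ⊆ Icc (lo + k * ℓ) (lo + (k + 2) * ℓ) :=
      Icc_subset_Icc le_rfl (by nlinarith)
    have hSvol : ENNReal.ofReal (1 / 2 * (lo + (k + 2) * ℓ - (lo + k * ℓ))) ≤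
        volume (Icc (lo + k * ℓ) (lo + (k + 1) * ℓ)) := by
      rw [Real.volume_Icc]
      apply ENNReal.ofReal_le_ofReal
      nlinarith
    have hy0 : 0 ≤ 8 ^ (k + 1) * x ^ (e₀ * ϑ ^ k) * M := by positivity
    have hyS : ∀ s ∈ Icc (lo + k * ℓ) (lo + (k + 1) * ℓ),
        |g s| ≤ 8 ^ (k + 1) * x ^ (e₀ * ϑ ^ k) * M := ih hkn
    have hshort' : lo + (k + 2) * ℓ - (lo + k * ℓ) ≤ (1 / 2) / (32 * Real.exp 1) * r := by
      nlinarith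
    have htJ : t ∈ Icc (lo + k * ℓ) (lo + (k + 2) * ℓ) := by
      refine ⟨?_, ?_⟩
      · have := ht.1; push_cast at this; nlinarith
      · have := ht.2; push_cast at this; nlinarith
    have h := abs_le_rpow_short hg hab hr hM hDJ hSsub (by norm_num : (0:ℝ) < 1 / 2)
      (by norm_num) hSvol hy0 hyS hshort' htJ
    have h16 : 16 * Real.exp 1 / (1 / 2) = 32 * Real.exp 1 := by ring
    rw [h16] at h
    -- algebra: `8 (8^{k+1} x^{e} M)^ϑ M^{1-ϑ} ≤ 8^{k+2} x^{eϑ} M`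
    have hsplit : (8 ^ (k + 1) * x ^ (e₀ * ϑ ^ k) * M) ^ ϑ =
        ((8:ℝ) ^ (k + 1)) ^ ϑ * x ^ (e₀ * ϑ ^ (k + 1)) * M ^ ϑ := by
      have h1 : (8 ^ (k + 1) * x ^ (e₀ * ϑ ^ k) * M) ^ ϑ =
          ((8:ℝ) ^ (k + 1) * x ^ (e₀ * ϑ ^ k)) ^ ϑ * M ^ ϑ :=
        Real.mul_rpow (by positivity) hM.le
      have h2 : ((8:ℝ) ^ (k + 1) * x ^ (e₀ * ϑ ^ k)) ^ ϑ =
          ((8:ℝ) ^ (k + 1)) ^ ϑ * (x ^ (e₀ * ϑ ^ k)) ^ ϑ :=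
        Real.mul_rpow (by positivity) (by positivity)
      have h3 : (x ^ (e₀ * ϑ ^ k)) ^ ϑ = x ^ (e₀ * ϑ ^ (k + 1)) := by
        rw [← Real.rpow_mul hx0, pow_succ, mul_assoc]
      rw [h1, h2, h3]
    have h8 : ((8:ℝ) ^ (k + 1)) ^ ϑ ≤ (8:ℝ) ^ (k + 1) := by
      have h81 : (1:ℝ) ≤ 8 ^ (k + 1) := one_le_pow₀ (by norm_num)
      calc ((8:ℝ) ^ (k + 1)) ^ ϑ ≤ ((8:ℝ) ^ (k + 1)) ^ (1:ℝ) :=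
            Real.rpow_le_rpow_of_exponent_le h81 hϑ1
        _ = 8 ^ (k + 1) := Real.rpow_one _
    have hMM : M ^ ϑ * M ^ (1 - ϑ) = M := by
      rw [← Real.rpow_add hM, add_sub_cancel, Real.rpow_one]
    calc |g t| ≤ 8 * (8 ^ (k + 1) * x ^ (e₀ * ϑ ^ k) * M) ^ ϑ * M ^ (1 - ϑ) := h
      _ = 8 * (((8:ℝ) ^ (k + 1)) ^ ϑ * x ^ (e₀ * ϑ ^ (k + 1))) * (M ^ ϑ * M ^ (1 - ϑ)) := by
          rw [hsplit]; ring
      _ ≤ 8 * ((8:ℝ) ^ (k + 1) * x ^ (e₀ * ϑ ^ (k + 1))) * (M ^ ϑ * M ^ (1 - ϑ)) := by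
          rw [hMM]
          gcongr
      _ = 8 ^ (k + 1 + 1) * x ^ (e₀ * ϑ ^ (k + 1)) * M := by rw [hMM]; ring

/-- Rightward propagation, uniform form on the whole run `[lo, lo + nℓ]`:
`|g| ≤ 8^{n+1} x^{e₀ ϑⁿ} M`. [folklore] -/
private theorem rightward_uniform {g : ℝ → ℝ} (hg : ContDiff ℝ (⊤ : ℕ∞) g) {lo ℓ M r x e₀ : ℝ} {n : ℕ}
    (hn : 0 < n) (hℓ : 0 < ℓ) (hM : 0 < M) (hr : 0 < r)
    (hshort : 2 * ℓ ≤ (1 / 2) / (32 * Real.exp 1) * r)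
    (hD : ∀ (k : ℕ), ∀ t ∈ Icc lo (lo + n * ℓ),
      |iteratedDeriv k g t| ≤ M * (k.factorial : ℝ) / r ^ k)
    (hx0 : 0 ≤ x) (hx1 : x ≤ 1) (he₀ : 0 < e₀)
    (hbase : ∀ t ∈ Icc lo (lo + ℓ), |g t| ≤ 8 * x ^ e₀ * M) :
    ∀ t ∈ Icc lo (lo + n * ℓ),
      |g t| ≤ 8 ^ (n + 1) * x ^ (e₀ * (Real.log 2 / Real.log (32 * Real.exp 1)) ^ n) * M := by
  intro t ht
  have he1 : 1 ≤ Real.exp 1 := Real.one_le_exp (by norm_num)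
  have h32 : (2 : ℝ) ≤ 32 * Real.exp 1 := by nlinarith
  have hlog2 : 0 < Real.log 2 := Real.log_pos (by norm_num)
  have hlog32 : 0 < Real.log (32 * Real.exp 1) := Real.log_pos (by nlinarith)
  have hϑpos : 0 < Real.log 2 / Real.log (32 * Real.exp 1) := div_pos hlog2 hlog32
  have hϑ1 : Real.log 2 / Real.log (32 * Real.exp 1) ≤ 1 :=
    (div_le_one hlog32).2 (Real.log_le_log (by norm_num) h32)
  obtain ⟨k, hk, hkt⟩ := exists_piece_of_mem hℓ hn ht
  exact (rightward hg hℓ hM hr hshort hD hx0 hbase k hk t hkt).trans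
    (chainBound_mono hx0 hx1 he₀ hϑpos hϑ1 hM.le hk.le)

/-- **One-dimensional propagation of smallness** for functions with factorial derivative bounds:
for `0 < σ ≤ 1`, `ρ' > 0` there are `N > 0`, `θ ∈ (0,1]` such that a smooth `g` with
`|g⁽ᵏ⁾| ≤ M k!/rᵏ` on `[a,b]`, `ρ'(b-a) ≤ r`, which is `≤ B` on a subset of `[a,b]` of measure
`≥ σ(b-a)`, satisfies `|g| ≤ N B^θ M^{1-θ}` on `[a,b]`.  (The `L^∞` one-dimensional case of
Vessella 1999 / Apraiz–Escauriaza–Wang–Zhang 2014 Thm 4, with non-optimised constants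
`N = 8^{m+1}`, `θ = θ_σ θ_{1/2}^m`, `m = ⌈128e/(σρ')⌉`.)
[cite: ApraizEscauriazaWangZhang2014, Theorem 4 (case n = 1)] -/
theorem exists_oneDim_propagation {σ ρ' : ℝ} (hσ : 0 < σ) (hσ1 : σ ≤ 1) (hρ' : 0 < ρ') :
    ∃ N θ : ℝ, 0 < N ∧ 0 < θ ∧ θ ≤ 1 ∧
      ∀ (g : ℝ → ℝ) (a b M r : ℝ), ContDiff ℝ (⊤ : ℕ∞) g → a < b → 0 < M → ρ' * (b - a) ≤ r →
        (∀ (k : ℕ), ∀ t ∈ Icc a b, |iteratedDeriv k g t| ≤ M * (k.factorial : ℝ) / r ^ k) →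
        ∀ (S : Set ℝ), S ⊆ Icc a b → ENNReal.ofReal (σ * (b - a)) ≤ volume S →
        ∀ (B : ℝ), 0 ≤ B → (∀ y ∈ S, |g y| ≤ B) →
        ∀ t ∈ Icc a b, |g t| ≤ N * B ^ θ * M ^ (1 - θ) := by
  -- the constants (kept opaque: tactics must not unfold `⌈·⌉₊`, `log`, `exp`)
  obtain ⟨E, hE⟩ : ∃ E : ℝ, E = Real.exp 1 := ⟨_, rfl⟩
  obtain ⟨θσ, hθσ⟩ : ∃ θσ : ℝ, θσ = Real.log 2 / Real.log (16 * Real.exp 1 / σ) := ⟨_, rfl⟩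
  obtain ⟨ϑ, hϑ⟩ : ∃ ϑ : ℝ, ϑ = Real.log 2 / Real.log (32 * Real.exp 1) := ⟨_, rfl⟩
  obtain ⟨m, hm⟩ : ∃ m : ℕ, m = ⌈128 * E / (σ * ρ')⌉₊ := ⟨_, rfl⟩
  have he1 : 1 ≤ E := by rw [hE]; exact Real.one_le_exp (by norm_num)
  have hEpos : 0 < E := by linarith
  have h32 : (2 : ℝ) ≤ 32 * Real.exp 1 := by rw [← hE]; linarith
  have hlog2 : 0 < Real.log 2 := Real.log_pos (by norm_num)
  have hlog32 : 0 < Real.log (32 * Real.exp 1) := Real.log_pos (by linarith)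
  have hϑpos : 0 < ϑ := by rw [hϑ]; exact div_pos hlog2 hlog32
  have hϑ1 : ϑ ≤ 1 := by rw [hϑ]; exact (div_le_one hlog32).2 (Real.log_le_log (by norm_num) h32)
  have h16σ : (2 : ℝ) ≤ 16 * Real.exp 1 / σ := by
    rw [le_div_iff₀ hσ, ← hE]; linarith
  have hlog16 : 0 < Real.log (16 * Real.exp 1 / σ) := Real.log_pos (by linarith)
  have hθσpos : 0 < θσ := by rw [hθσ]; exact div_pos hlog2 hlog16
  have hθσ1 : θσ ≤ 1 := by
    rw [hθσ]; exact (div_le_one hlog16).2 (Real.log_le_log (by norm_num) h16σ)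
  have hσρ : 0 < σ * ρ' := mul_pos hσ hρ'
  have hmpos : 0 < m := by rw [hm]; exact Nat.ceil_pos.2 (by positivity)
  have hmge : 128 * E / (σ * ρ') ≤ m := by rw [hm]; exact Nat.le_ceil _
  have hmR : (0 : ℝ) < m := by exact_mod_cast hmpos
  refine ⟨8 ^ (m + 1), θσ * ϑ ^ m, by positivity, by positivity,
    mul_le_one₀ hθσ1 (by positivity) (pow_le_one₀ hϑpos.le hϑ1), ?_⟩
  intro g a b M r hg hab hM hr hD S hS hSvol B hB0 hB t ht
  obtain ⟨θ, hθ⟩ : ∃ θ : ℝ, θ = θσ * ϑ ^ m := ⟨_, rfl⟩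
  rw [← hθ]
  have hθpos : 0 < θ := by rw [hθ]; positivity
  have hba : 0 < b - a := sub_pos.2 hab
  have hrpos : 0 < r := lt_of_lt_of_le (by positivity) hr
  have hpow0 : 0 ≤ B ^ θ * M ^ (1 - θ) := by positivity
  have hN1 : (1 : ℝ) ≤ 8 ^ (m + 1) := one_le_pow₀ (by norm_num)
  -- the trivial bound and the case `M ≤ B`
  have hgM : |g t| ≤ M := by simpa using hD 0 t ht
  by_cases hBM : M ≤ B
  · have h1 : M ≤ B ^ θ * M ^ (1 - θ) := by
      calc M = M ^ θ * M ^ (1 - θ) := by rw [← Real.rpow_add hM, add_sub_cancel, Real.rpow_one]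
        _ ≤ B ^ θ * M ^ (1 - θ) := by gcongr
    calc |g t| ≤ M := hgM
      _ ≤ 1 * (B ^ θ * M ^ (1 - θ)) := by rw [one_mul]; exact h1
      _ ≤ 8 ^ (m + 1) * (B ^ θ * M ^ (1 - θ)) := by gcongr
      _ = 8 ^ (m + 1) * B ^ θ * M ^ (1 - θ) := by ring
  push Not at hBM
  obtain ⟨x, hx⟩ : ∃ x : ℝ, x = B / M := ⟨_, rfl⟩
  have hx0 : 0 ≤ x := by rw [hx]; exact div_nonneg hB0 hM.le
  have hx1 : x ≤ 1 := by rw [hx]; exact (div_le_one hM).2 hBM.le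
  have hxid : ∀ e : ℝ, x ^ e * M = B ^ e * M ^ (1 - e) := fun e => by
    rw [hx, Real.div_rpow hB0 hM.le, Real.rpow_sub hM, Real.rpow_one]
    field_simp
  -- the pieces: `ℓ = (b - a)/m`
  obtain ⟨ℓ, hℓ⟩ : ∃ ℓ : ℝ, ℓ = (b - a) / m := ⟨_, rfl⟩
  have hℓpos : 0 < ℓ := by rw [hℓ]; exact div_pos hba hmR
  have hmℓ : (m : ℝ) * ℓ = b - a := by rw [hℓ]; field_simp
  have hbℓ : b = a + m * ℓ := by linarith
  -- `ℓ ≤ σρ'(b-a)/(128E) ≤ σ r/(128 E)`, whence the two shortness conditions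
  have hℓ1 : ℓ * (128 * E) ≤ σ * ρ' * (b - a) := by
    have h1 : 128 * E ≤ m * (σ * ρ') := (div_le_iff₀ hσρ).1 hmge
    have h2 : ℓ * (128 * E) ≤ ℓ * (m * (σ * ρ')) := mul_le_mul_of_nonneg_left h1 hℓpos.le
    calc ℓ * (128 * E) ≤ ℓ * (m * (σ * ρ')) := h2
      _ = σ * ρ' * (m * ℓ) := by ring
      _ = σ * ρ' * (b - a) := by rw [hmℓ]
  have hℓ2 : ℓ * (128 * E) ≤ σ * r := by
    calc ℓ * (128 * E) ≤ σ * ρ' * (b - a) := hℓ1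
      _ = σ * (ρ' * (b - a)) := by ring
      _ ≤ σ * r := mul_le_mul_of_nonneg_left hr hσ.le
  have hℓE : 0 < ℓ * E := mul_pos hℓpos hEpos
  have hshort1 : ℓ ≤ σ / (32 * Real.exp 1) * r := by
    rw [← hE, div_mul_eq_mul_div, le_div_iff₀ (by positivity)]
    linarith
  have hshort2 : 2 * ℓ ≤ (1 / 2) / (32 * Real.exp 1) * r := by
    rw [← hE, div_mul_eq_mul_div, le_div_iff₀ (by positivity)]
    have : σ * r ≤ 1 * r := mul_le_mul_of_nonneg_right hσ1 hrpos.le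
    linarith
  -- the dense piece
  have hS' : S ⊆ Icc a (a + m * ℓ) := by rw [← hbℓ]; exact hS
  have hSvol' : ENNReal.ofReal (σ * (m * ℓ)) ≤ volume S := by rw [hmℓ]; exact hSvol
  obtain ⟨i, him, hi⟩ := exists_dense_piece hℓpos hmpos hS' hSvol'
  have hiR : (i : ℝ) + 1 ≤ m := by exact_mod_cast Nat.succ_le_of_lt him
  have hi0 : (0 : ℝ) ≤ i := Nat.cast_nonneg i
  -- base bound on the dense piece
  have hiℓ0 : 0 ≤ (i : ℝ) * ℓ := mul_nonneg hi0 hℓpos.le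
  have hiℓ1 : ((i : ℝ) + 1) * ℓ ≤ m * ℓ := mul_le_mul_of_nonneg_right hiR hℓpos.le
  have hpiece_sub : Icc (a + i * ℓ) (a + (i + 1) * ℓ) ⊆ Icc a b :=
    Icc_subset_Icc (by linarith) (by linarith)
  have hDp : ∀ (k : ℕ), ∀ s ∈ Icc (a + i * ℓ) (a + (i + 1) * ℓ),
      |iteratedDeriv k g s| ≤ M * (k.factorial : ℝ) / r ^ k :=
    fun k s hs => hD k s (hpiece_sub hs)
  have hlen : a + (i + 1) * ℓ - (a + i * ℓ) = ℓ := by ring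
  have habp : a + i * ℓ < a + (i + 1) * ℓ := by linarith
  have hSvolp : ENNReal.ofReal (σ * (a + (i + 1) * ℓ - (a + i * ℓ))) ≤
      volume (S ∩ Icc (a + i * ℓ) (a + (i + 1) * ℓ)) := by rw [hlen]; exact hi
  have hshortp : a + (i + 1) * ℓ - (a + i * ℓ) ≤ σ / (32 * Real.exp 1) * r := by
    rw [hlen]; exact hshort1
  have hbase : ∀ s ∈ Icc (a + i * ℓ) (a + (i + 1) * ℓ), |g s| ≤ 8 * x ^ θσ * M := by
    intro s hs
    have h := abs_le_rpow_short hg habp hrpos hM hDp inter_subset_right hσ hσ1 hSvolp hB0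
      (fun y hy => hB y hy.1) hshortp hs
    rw [← hθσ] at h
    rw [mul_assoc, hxid θσ, ← mul_assoc]
    exact h
  -- final form of the bound
  have hfin : (8:ℝ) ^ (m + 1) * x ^ (θσ * ϑ ^ m) * M = 8 ^ (m + 1) * B ^ θ * M ^ (1 - θ) := by
    rw [mul_assoc, hxid (θσ * ϑ ^ m), ← mul_assoc, hθ]
  rw [← hfin]
  rcases le_or_gt (a + i * ℓ) t with hti | hti
  · -- rightward run from the dense piece: `lo = a + iℓ`, `n = m - i` pieces
    have hn : 0 < m - i := Nat.sub_pos_of_lt him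
    have hcast : ((m - i : ℕ) : ℝ) = m - i := Nat.cast_sub him.le
    have hrun : a + i * ℓ + ((m - i : ℕ) : ℝ) * ℓ = b := by rw [hcast, hbℓ]; ring
    have hDr : ∀ (k : ℕ), ∀ s ∈ Icc (a + i * ℓ) (a + i * ℓ + ((m - i : ℕ) : ℝ) * ℓ),
        |iteratedDeriv k g s| ≤ M * (k.factorial : ℝ) / r ^ k := by
      intro k s hs
      rw [hrun] at hs
      exact hD k s ⟨by linarith [hs.1], hs.2⟩
    have hbase' : ∀ s ∈ Icc (a + i * ℓ) (a + i * ℓ + ℓ), |g s| ≤ 8 * x ^ θσ * M :=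
      fun s hs => hbase s ⟨hs.1, by linarith [hs.2]⟩
    have htr : t ∈ Icc (a + i * ℓ) (a + i * ℓ + ((m - i : ℕ) : ℝ) * ℓ) := by
      rw [hrun]; exact ⟨hti, ht.2⟩
    have h := rightward_uniform hg hn hℓpos hM hrpos hshort2 hDr hx0 hx1 hθσpos hbase' t htr
    rw [← hϑ] at h
    exact h.trans (chainBound_mono hx0 hx1 hθσpos hϑpos hϑ1 hM.le (Nat.sub_le m i))
  · -- leftward run = rightward run of the reflected function `s ↦ g (-s)` on
    -- `[-(a + (i+1)ℓ), -a]`, `n = i + 1` pieces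
    obtain ⟨g', hg'⟩ : ∃ g' : ℝ → ℝ, g' = fun s => g (-s) := ⟨_, rfl⟩
    have hg'c : ContDiff ℝ (⊤ : ℕ∞) g' := by rw [hg']; exact hg.comp contDiff_neg
    have hcast : ((i + 1 : ℕ) : ℝ) = i + 1 := by push_cast; ring
    have hrun : -(a + (i + 1) * ℓ) + ((i + 1 : ℕ) : ℝ) * ℓ = -a := by rw [hcast]; ring
    have hDl : ∀ (k : ℕ), ∀ s ∈ Icc (-(a + (i + 1) * ℓ)) (-(a + (i + 1) * ℓ) + ((i + 1 : ℕ) : ℝ) * ℓ),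
        |iteratedDeriv k g' s| ≤ M * (k.factorial : ℝ) / r ^ k := by
      intro k s hs
      rw [hrun] at hs
      have hs' : -s ∈ Icc a b := by
        refine ⟨by linarith [hs.2], ?_⟩
        have h1 : a + (i + 1) * ℓ ≤ b := (hpiece_sub ⟨habp.le, le_rfl⟩).2
        linarith [hs.1]
      rw [hg', iteratedDeriv_comp_neg, smul_eq_mul, abs_mul, abs_pow, abs_neg, abs_one, one_pow,
        one_mul]
      exact hD k (-s) hs'
    have hbase' : ∀ s ∈ Icc (-(a + (i + 1) * ℓ)) (-(a + (i + 1) * ℓ) + ℓ),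
        |g' s| ≤ 8 * x ^ θσ * M := by
      intro s hs
      have : -s ∈ Icc (a + i * ℓ) (a + (i + 1) * ℓ) := ⟨by linarith [hs.2], by linarith [hs.1]⟩
      rw [hg']
      exact hbase (-s) this
    have htl : -t ∈ Icc (-(a + (i + 1) * ℓ)) (-(a + (i + 1) * ℓ) + ((i + 1 : ℕ) : ℝ) * ℓ) := by
      rw [hrun]
      refine ⟨?_, by linarith [ht.1]⟩
      have : (i : ℝ) * ℓ ≤ (i + 1) * ℓ := mul_le_mul_of_nonneg_right (by linarith) hℓpos.le
      linarith
    have h := rightward_uniform hg'c (Nat.succ_pos i) hℓpos hM hrpos hshort2 hDl hx0 hx1 hθσpos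
      hbase' (-t) htl
    have hgt : g' (-t) = g t := by rw [hg']; simp
    rw [hgt, ← hϑ] at h
    exact h.trans (chainBound_mono hx0 hx1 hθσpos hϑpos hϑ1 hM.le (Nat.succ_le_of_lt him))

end AnalyticSmallness

end Literature.Analysis.PDE

end
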